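import Summits.BirchSwinnertonDyer.BirchSwinnertonDyer.Theorems.GoldfeldAllTwistsTwoConverseTwinAdditiveCellModel
import HarnessLib

set_option linter.dupNamespace false -- `…BirchSwinnertonDyer.BirchSwinnertonDyer…` is the cell's namespace (D-0017)
set_option autoImplicit false

/-!
# Twin″ (item 19140), the WHOLE additive cell — uniform local arithmetic, II: the Tamagawa number of `49a1^{(d)}` at
# every odd prime `ℓ ∣ d`, `ℓ ≠ 7`: **`c_ℓ = 2` if `(−7/ℓ) = −1`, `c_ℓ = 4` if `(−7/ℓ) = +1`** (generic in `d` and `ℓ`)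

Cell `bsd-goldfeld`, seat `bsd-goldfeld-s1p-c301` (prover, gen 11). Support for item `stmt-BirchSwinnertonDyer-19140`
(crux twin″ `BSDTwoCMSevenAdditiveRankOne`). Theses-free; theorems only; no `sorry`. HONEST FRAMING: local arithmetic of
an explicit two-parameter family of Weierstrass models; nothing about `L`-values; BSD is not proved by any of this and
no case of twin″ is claimed.

Setting: `d` squarefree, `d ≢ 1 (mod 4)`, `M_d = [0, −3d, 0, −32d², −64d³]` the global minimal model of `49a1^{(d)}`
(file I `…TwinAdditiveCellModel`: `isGloballyMinimal_cellModel`), `ℓ` an odd prime dividing `d`, `ℓ ≠ 7`, `d = ℓ·e`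
(`ℓ ∤ e`, squarefreeness). WHAT IS PROVED:
* §1 over `ℤ_ℓ` the model is Tate's Step-6 normal form (`a₂ = ℓ·(−3e)`, `a₄ = ℓ²·(−32e²)`, `a₆ = ℓ³·(−64e³)`), type
  `I₀*`, with separable residue cubic `T³ − 3ēT² − 32ē²T − 64ē³ = (T − 8ē)(T² + 5ēT + 8ē²)` (discriminant
  `−2⁸·7³·ē⁶ ≠ 0`), `disc(T² + 5ēT + 8ē²) = −7ē²`; so the root set is `{8ē}` when `(−7/ℓ) = −1`
  (`residue_cellCubic_root_iff_of_legendreSym_eq_neg_one`) and has exactly three elements `8ē`, `ē(−5 ± σ)/2`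
  (`σ² = −7`; distinct since `ℓ ∤ 448`) when `(−7/ℓ) = +1` (`residue_cellCubic_roots_of_legendreSym_eq_one`); Tate's
  exact count `[E(ℚ_ℓ) : E₀(ℚ_ℓ)] = 1 + #roots` (`Rank2Observatory.Tam.index_Istar_zero_eq_card_add_one`, case 6 of
  [Tate1975] §7) gives the index `2`, resp. `4`, and — read on the minimal model
  (`LocalIndex.localTamagawaNumber_eq_index_of_smul_eq_baseChange`, minimality from file I) —
  **`c_ℓ(49a1^{(d)}) = 2`** (`localTamagawaNumber_padic_cellModel_eq_two`), resp. **`= 4`** (`…_eq_four`).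
  Seat c301 gen 8 proved the case `d = −q`, `ℓ = q` prime inert (`localTamagawaNumber_padic_twist_q`).
* §2 `(−7/ℓ) = (ℓ/7)` for every odd `ℓ` (`jacobiSym_neg_seven_eq_of_odd`, `legendreSym_neg_seven_eq_jacobiSym`): the
  dichotomy is «`ℓ` inert / split in `ℚ(√−7)`» in either of the cell's spellings.
CONSEQUENCE (bookkeeping, not filed here): with `c₂ = 4` and `c₇ = 2` on the additive cell (sibling file III) the
Tamagawa product of every curve of the cell is `∏_p c_p = 2^(3 + ι(d) + 2σ(d))`, `ι / σ` = the number of odd prime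
factors of `d` inert / split in `ℚ(√−7)` — the exponent `v` of memo INERT7-FORMULA-CENSUS §0.2 and of B49K-SCOPING §2.

Numerical cross-check (this seat, kit job j277601, PARI `elllocalred`, all 485 squarefree `|d| ≤ 400`): `c_ℓ = 2 / 4`
exactly by `(−7/ℓ)` at every odd `ℓ ∣ d`, `ℓ ≠ 7` (0 exceptions); `c₂ = 4` (types `I₄*` / `I₈*`) and `c₇ = 2` (type
`III`) on the whole additive cell.
References: [Tate1975] §7 case 6; [Silverman1994] IV.9.4 Step 6, Table 4.1; [SilvermanAEC2009] VII.1 Rem. 1.1, VII.6.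
-/

noncomputable section

open scoped Classical NumberField

open WeierstrassCurve IsDedekindDomain IsLocalRing Rat.HeightOneSpectrum
  Literature.NumberTheory.EllipticCurves Literature.NumberTheory.EllipticCurves.ModularForms
  Literature.NumberTheory.QuadraticForms
  Summit.BirchSwinnertonDyer.BirchSwinnertonDyer.Rank2Observatory.Tate
  Summit.BirchSwinnertonDyer.BirchSwinnertonDyer.Rank2Observatory.RootNumber
  Summit.BirchSwinnertonDyer.BirchSwinnertonDyer.Rank2Observatory.Tam

namespace Summit.BirchSwinnertonDyer.BirchSwinnertonDyer.Theorems.GoldfeldGoodTwists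

/-! ## §1 The odd places `ℓ ∣ d`, `ℓ ≠ 7`: type `I₀*`, `c_ℓ = 2` or `4` according to `(−7/ℓ)` -/

section OddPlace

variable {d : ℤ} {l : ℕ}

/-- `M_d ⊗ ℚ ⊗ ℚ_p` is the base change of the `ℤ_p`-model with the same coefficients. [folklore] -/
theorem cellModel_baseChange_padic (d : ℤ) (p : ℕ) [Fact p.Prime] :
    ((⟨0, -3 * d, 0, -32 * d ^ 2, -64 * d ^ 3⟩ : WeierstrassCurve ℤ).baseChange ℚ).baseChange ℚ_[p] =
      (⟨0, -3 * (d : ℤ_[p]), 0, -32 * (d : ℤ_[p]) ^ 2, -64 * (d : ℤ_[p]) ^ 3⟩ : WeierstrassCurve ℤ_[p]).baseChange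
        ℚ_[p] := by
  ext <;> simp only [baseChange, map_a₁, map_a₂, map_a₃, map_a₄, map_a₆, map_neg, map_mul, map_pow, map_ofNat,
    map_intCast, map_zero, algebraMap_int_eq, eq_intCast]

/-- The residue of an integer `e` in `𝔽_ℓ = ℤ_ℓ/ℓ` vanishes iff `ℓ ∣ e`. [folklore] -/
theorem residue_intCast_eq_zero_iff [Fact l.Prime] (e : ℤ) :
    residue ℤ_[l] (e : ℤ_[l]) = 0 ↔ (l : ℤ) ∣ e := by
  rw [residue_eq_zero_iff, mem_maximalIdeal, PadicInt.mem_nonunits, PadicInt.norm_int_lt_one_iff_dvd]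

/-- The discriminant of the residue cubic `T³ − 3ēT² − 32ē²T − 64ē³` is `−2⁸·7³·ē⁶ ≠ 0` for `ℓ ∤ 14e`.
[cite: Tate1975, §7 (case 6)] -/
theorem residue_cellCubic_disc_ne_zero [Fact l.Prime] (hl2 : l ≠ 2) (hl7 : l ≠ 7) {e : ℤ}
    (he : ¬ (l : ℤ) ∣ e) :
    residue ℤ_[l] (-3 * (e : ℤ_[l])) ^ 2 * residue ℤ_[l] (-32 * (e : ℤ_[l]) ^ 2) ^ 2 -
        4 * residue ℤ_[l] (-32 * (e : ℤ_[l]) ^ 2) ^ 3 -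
        4 * residue ℤ_[l] (-3 * (e : ℤ_[l])) ^ 3 * residue ℤ_[l] (-64 * (e : ℤ_[l]) ^ 3) -
        27 * residue ℤ_[l] (-64 * (e : ℤ_[l]) ^ 3) ^ 2 +
        18 * residue ℤ_[l] (-3 * (e : ℤ_[l])) * residue ℤ_[l] (-32 * (e : ℤ_[l]) ^ 2) *
          residue ℤ_[l] (-64 * (e : ℤ_[l]) ^ 3) ≠ 0 := by
  have hē : residue ℤ_[l] (e : ℤ_[l]) ≠ 0 := fun h => he ((residue_intCast_eq_zero_iff e).mp h)
  have h87 : (87808 : ResidueField ℤ_[l]) ≠ 0 := residue_disc_ne_zero hl2 hl7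
  simp only [map_mul, map_neg, map_pow, map_ofNat]
  have : -(87808 : ResidueField ℤ_[l]) * residue ℤ_[l] (e : ℤ_[l]) ^ 6 ≠ 0 :=
    mul_ne_zero (neg_ne_zero.mpr h87) (pow_ne_zero _ hē)
  intro h0
  apply this
  linear_combination h0

/-- **The residue cubic `T³ − 3ēT² − 32ē²T − 64ē³ = (T − 8ē)(T² + 5ēT + 8ē²)` has `8ē` as its ONLY root in `𝔽_ℓ`**
when `(−7/ℓ) = −1` (and `ℓ ∤ e`): a root of `T² + 5ēT + 8ē²` would give `((2T + 5ē)/ē)² = −7`.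
[cite: Tate1975, §7 (case 6)] -/
theorem residue_cellCubic_root_iff_of_legendreSym_eq_neg_one [Fact l.Prime] (hl7 : legendreSym l (-7) = -1)
    {e : ℤ} (he : ¬ (l : ℤ) ∣ e) (r : ResidueField ℤ_[l]) :
    r ^ 3 + residue ℤ_[l] (-3 * (e : ℤ_[l])) * r ^ 2 + residue ℤ_[l] (-32 * (e : ℤ_[l]) ^ 2) * r +
        residue ℤ_[l] (-64 * (e : ℤ_[l]) ^ 3) = 0 ↔ r = 8 * residue ℤ_[l] (e : ℤ_[l]) := by
  set ē := residue ℤ_[l] (e : ℤ_[l]) with hēdef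
  have hē : ē ≠ 0 := fun h => he ((residue_intCast_eq_zero_iff e).mp h)
  simp only [map_mul, map_neg, map_pow, map_ofNat]
  constructor
  · intro h
    have hfac : (r - 8 * ē) * (r ^ 2 + 5 * ē * r + 8 * ē ^ 2) = 0 := by linear_combination h
    rcases mul_eq_zero.mp hfac with h1 | h2
    · linear_combination h1
    · exfalso
      have hsq : ((2 * r + 5 * ē) * ē⁻¹) ^ 2 = -7 := by
        have h3 : (2 * r + 5 * ē) ^ 2 = -7 * ē ^ 2 := by linear_combination 4 * h2
        field_simp
        linear_combination h3
      have h7 : IsSquare ((-7 : ℤ) : ZMod l) := by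
        refine ⟨PadicInt.residueField (p := l) ((2 * r + 5 * ē) * ē⁻¹), ?_⟩
        rw [← sq, ← map_pow, hsq]
        push_cast
        rw [map_neg, map_ofNat]
      exact (legendreSym.eq_neg_one_iff (p := l)).mp hl7 h7
  · rintro rfl
    ring

/-- **When `(−7/ℓ) = +1` the residue cubic has exactly THREE roots** `8ē`, `ē(−5 ± σ)/2` (`σ² = −7` in `𝔽_ℓ`,
`ℓ ∤ 14e`): they are pairwise distinct since `σ ≠ 0` (`ℓ ≠ 7`) and `σ = ±21` would force `ℓ ∣ 448 = 2⁶·7`.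
[cite: Tate1975, §7 (case 6)] -/
theorem residue_cellCubic_roots_of_legendreSym_eq_one [Fact l.Prime] (hl2 : l ≠ 2) (hl7' : l ≠ 7)
    (hl7 : legendreSym l (-7) = 1) {e : ℤ} (he : ¬ (l : ℤ) ∣ e) :
    ∃ S : Finset (ResidueField ℤ_[l]), S.card = 3 ∧ ∀ r, r ∈ S ↔
      r ^ 3 + residue ℤ_[l] (-3 * (e : ℤ_[l])) * r ^ 2 + residue ℤ_[l] (-32 * (e : ℤ_[l]) ^ 2) * r +
        residue ℤ_[l] (-64 * (e : ℤ_[l]) ^ 3) = 0 := by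
  have hl : l.Prime := Fact.out
  set ē := residue ℤ_[l] (e : ℤ_[l]) with hēdef
  have hē : ē ≠ 0 := fun h => he ((residue_intCast_eq_zero_iff e).mp h)
  -- a square root of `−7` in `𝔽_ℓ`, transported from `ZMod ℓ`
  have h70 : ((-7 : ℤ) : ZMod l) ≠ 0 := by
    intro h0
    have h1 : ((7 : ℕ) : ZMod l) = 0 := by
      have : ((7 : ℤ) : ZMod l) = 0 := by rw [show (7 : ℤ) = -(-7 : ℤ) by norm_num, Int.cast_neg, h0, neg_zero]
      exact_mod_cast this
    rw [ZMod.natCast_eq_zero_iff] at h1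
    exact hl7' ((Nat.prime_dvd_prime_iff_eq hl (by norm_num)).mp h1)
  obtain ⟨s, hs⟩ := (legendreSym.eq_one_iff l h70).mp hl7
  set σ : ResidueField ℤ_[l] := (PadicInt.residueField (p := l)).symm s with hσdef
  have hσ : σ ^ 2 = -7 := by
    apply (PadicInt.residueField (p := l)).injective
    rw [map_pow, hσdef, RingEquiv.apply_symm_apply, sq, ← hs]
    push_cast
    rw [map_neg, map_ofNat]
  -- `2` and `448` are invertible in `𝔽_ℓ`
  have hnat : ∀ n : ℕ, (n : ResidueField ℤ_[l]) = 0 → l ∣ n := fun n hn => by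
    have h1 := congrArg (PadicInt.residueField (p := l)) hn
    rw [map_natCast, map_zero] at h1
    exact (ZMod.natCast_eq_zero_iff n l).mp h1
  have h2 : (2 : ResidueField ℤ_[l]) ≠ 0 := fun h =>
    hl2 ((Nat.prime_dvd_prime_iff_eq hl Nat.prime_two).mp (hnat 2 (by exact_mod_cast h)))
  have h448 : (448 : ResidueField ℤ_[l]) ≠ 0 := fun h => by
    have h3 : l ∣ 2 ^ 6 * 7 := by norm_num; exact hnat 448 (by exact_mod_cast h)
    rcases (Nat.Prime.dvd_mul hl).mp h3 with h | h
    · exact hl2 ((Nat.prime_dvd_prime_iff_eq hl Nat.prime_two).mp (hl.dvd_of_dvd_pow h))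
    · exact hl7' ((Nat.prime_dvd_prime_iff_eq hl (by norm_num)).mp h)
  have hσ0 : σ ≠ 0 := fun h => by
    rw [h, zero_pow two_ne_zero] at hσ
    have : (7 : ResidueField ℤ_[l]) = 0 := by linear_combination hσ
    exact hl7' ((Nat.prime_dvd_prime_iff_eq hl (by norm_num)).mp (hnat 7 (by exact_mod_cast this)))
  -- the three roots
  set a := ē * (-5 + σ) * (2 : ResidueField ℤ_[l])⁻¹ with hadef
  set b := ē * (-5 - σ) * (2 : ResidueField ℤ_[l])⁻¹ with hbdef
  have ht : (2 : ResidueField ℤ_[l]) * (2 : ResidueField ℤ_[l])⁻¹ = 1 := mul_inv_cancel₀ h2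
  have hquad : ∀ r : ResidueField ℤ_[l], r ^ 2 + 5 * ē * r + 8 * ē ^ 2 = (r - a) * (r - b) := fun r => by
    rw [hadef, hbdef]
    linear_combination (-(5 * ē * r + 8 * ē ^ 2 * (1 + 2 * (2 : ResidueField ℤ_[l])⁻¹))) * ht +
      (2 : ResidueField ℤ_[l])⁻¹ ^ 2 * ē ^ 2 * hσ
  have hab : a ≠ b := fun h => by
    have h' : -5 + σ = -5 - σ := mul_left_cancel₀ hē (mul_right_cancel₀ (inv_ne_zero h2) h)
    have h'' : (2 : ResidueField ℤ_[l]) * σ = 0 := by linear_combination h'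
    rcases mul_eq_zero.mp h'' with h1 | h1
    · exact h2 h1
    · exact hσ0 h1
  have h8a : 8 * ē ≠ a := fun h => by
    have h0 : 8 * ē * 2 = ē * (-5 + σ) := by rw [h, hadef, inv_mul_cancel_right₀ h2]
    have h' : ē * (21 - σ) = 0 := by linear_combination h0
    rcases mul_eq_zero.mp h' with h1 | h1
    · exact hē h1
    · have hσ21 : σ = 21 := by linear_combination -h1
      rw [hσ21] at hσ
      exact h448 (by linear_combination hσ)
  have h8b : 8 * ē ≠ b := fun h => by
    have h0 : 8 * ē * 2 = ē * (-5 - σ) := by rw [h, hbdef, inv_mul_cancel_right₀ h2]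
    have h' : ē * (21 + σ) = 0 := by linear_combination h0
    rcases mul_eq_zero.mp h' with h1 | h1
    · exact hē h1
    · have hσ21 : σ = -21 := by linear_combination h1
      rw [hσ21] at hσ
      exact h448 (by linear_combination hσ)
  refine ⟨{8 * ē, a, b}, ?_, fun r => ?_⟩
  · rw [Finset.card_insert_of_notMem (by simp [h8a, h8b]), Finset.card_pair hab]
  · simp only [Finset.mem_insert, Finset.mem_singleton, map_mul, map_neg, map_pow, map_ofNat]
    rw [← hēdef]
    constructor
    · rintro (rfl | rfl | rfl)
      · ring
      · have := hquad a
        linear_combination (a - 8 * ē) * this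
      · have := hquad b
        linear_combination (b - 8 * ē) * this
    · intro h
      have hfac : (r - 8 * ē) * (r ^ 2 + 5 * ē * r + 8 * ē ^ 2) = 0 := by linear_combination h
      rw [hquad r] at hfac
      rcases mul_eq_zero.mp hfac with h1 | h1
      · exact Or.inl (by linear_combination h1)
      · rcases mul_eq_zero.mp h1 with h3 | h3
        · exact Or.inr (Or.inl (by linear_combination h3))
        · exact Or.inr (Or.inr (by linear_combination h3))

/-- `Δ(M_d) ≠ 0` in `ℤ_ℓ` for `d ≠ 0`. [folklore] -/
theorem cellModel_padic_Δ_ne_zero [Fact l.Prime] (hd0 : d ≠ 0) :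
    (⟨0, -3 * (d : ℤ_[l]), 0, -32 * (d : ℤ_[l]) ^ 2, -64 * (d : ℤ_[l]) ^ 3⟩ : WeierstrassCurve ℤ_[l]).Δ ≠ 0 := by
  have hJ : (⟨0, -3 * (d : ℤ_[l]), 0, -32 * (d : ℤ_[l]) ^ 2, -64 * (d : ℤ_[l]) ^ 3⟩ : WeierstrassCurve ℤ_[l]) =
      (⟨0, -3 * d, 0, -32 * d ^ 2, -64 * d ^ 3⟩ : WeierstrassCurve ℤ).map (Int.castRingHom ℤ_[l]) := by
    ext <;> simp [WeierstrassCurve.map]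
  rw [hJ, map_Δ, cellModel_Δ]
  simp only [eq_intCast, ne_eq, Int.cast_eq_zero, neg_eq_zero]
  positivity

/-- **`[E(ℚ_ℓ) : E₀(ℚ_ℓ)] = 2` for `M_d` over `ℤ_ℓ`** when `d = ℓ·e`, `ℓ ∤ 14e`, `(−7/ℓ) = −1` (Step-6 normal form, exact
`I₀*` count with root set `{8ē}`). [cite: Tate1975, §7 (case 6)] [cite: Silverman1994, IV.9.4 Step 6] -/
theorem index_nonsingularReductionSubgroup_cellModel_eq_two [Fact l.Prime] (hl2 : l ≠ 2) (hl7' : l ≠ 7)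
    (hl7 : legendreSym l (-7) = -1) {e : ℤ} (he : ¬ (l : ℤ) ∣ e) (hd : d = l * e) :
    ((⟨0, -3 * (d : ℤ_[l]), 0, -32 * (d : ℤ_[l]) ^ 2, -64 * (d : ℤ_[l]) ^ 3⟩ : WeierstrassCurve ℤ_[l])
      |>.nonsingularReductionSubgroup (integers_valuationRing_valuation ℤ_[l] ℚ_[l])).index = 2 := by
  haveI : HenselianLocalRing ℤ_[l] :=
    { is_henselian := fun f hf a₀ h₁ h₂ =>
        HenselianRing.is_henselian (I := IsLocalRing.maximalIdeal ℤ_[l]) f hf a₀ h₁ (h₂.map _) }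
  have he0 : e ≠ 0 := by rintro rfl; exact he (dvd_zero _)
  have hd0 : d ≠ 0 := by rw [hd]; exact mul_ne_zero (by exact_mod_cast (Fact.out : l.Prime).ne_zero) he0
  have hdl : (d : ℤ_[l]) = (l : ℤ_[l]) * (e : ℤ_[l]) := by rw [hd]; push_cast; ring
  have h := index_Istar_zero_eq_card_add_one (K := ℚ_[l])
    (⟨0, -3 * (d : ℤ_[l]), 0, -32 * (d : ℤ_[l]) ^ 2, -64 * (d : ℤ_[l]) ^ 3⟩ : WeierstrassCurve ℤ_[l])
    PadicInt.irreducible_p (α := 0) (β := -3 * (e : ℤ_[l])) (γ := 0) (δ := -32 * (e : ℤ_[l]) ^ 2)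
    (ε := -64 * (e : ℤ_[l]) ^ 3) (by simp) (by simp only; rw [hdl]; ring) (by simp) (by simp only; rw [hdl]; ring)
    (by simp only; rw [hdl]; ring) (cellModel_padic_Δ_ne_zero hd0) (residue_cellCubic_disc_ne_zero hl2 hl7' he)
    {8 * residue ℤ_[l] (e : ℤ_[l])} (fun r => by
      rw [Finset.mem_singleton]
      exact (residue_cellCubic_root_iff_of_legendreSym_eq_neg_one hl7 he r).symm)
  rw [h, Finset.card_singleton]

/-- **`[E(ℚ_ℓ) : E₀(ℚ_ℓ)] = 4` for `M_d` over `ℤ_ℓ`** when `d = ℓ·e`, `ℓ ∤ 14e`, `(−7/ℓ) = +1` (three residue roots).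
[cite: Tate1975, §7 (case 6)] [cite: Silverman1994, IV.9.4 Step 6] -/
theorem index_nonsingularReductionSubgroup_cellModel_eq_four [Fact l.Prime] (hl2 : l ≠ 2) (hl7' : l ≠ 7)
    (hl7 : legendreSym l (-7) = 1) {e : ℤ} (he : ¬ (l : ℤ) ∣ e) (hd : d = l * e) :
    ((⟨0, -3 * (d : ℤ_[l]), 0, -32 * (d : ℤ_[l]) ^ 2, -64 * (d : ℤ_[l]) ^ 3⟩ : WeierstrassCurve ℤ_[l])
      |>.nonsingularReductionSubgroup (integers_valuationRing_valuation ℤ_[l] ℚ_[l])).index = 4 := by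
  haveI : HenselianLocalRing ℤ_[l] :=
    { is_henselian := fun f hf a₀ h₁ h₂ =>
        HenselianRing.is_henselian (I := IsLocalRing.maximalIdeal ℤ_[l]) f hf a₀ h₁ (h₂.map _) }
  have he0 : e ≠ 0 := by rintro rfl; exact he (dvd_zero _)
  have hd0 : d ≠ 0 := by rw [hd]; exact mul_ne_zero (by exact_mod_cast (Fact.out : l.Prime).ne_zero) he0
  have hdl : (d : ℤ_[l]) = (l : ℤ_[l]) * (e : ℤ_[l]) := by rw [hd]; push_cast; ring
  obtain ⟨S, hS3, hS⟩ := residue_cellCubic_roots_of_legendreSym_eq_one hl2 hl7' hl7 he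
  have h := index_Istar_zero_eq_card_add_one (K := ℚ_[l])
    (⟨0, -3 * (d : ℤ_[l]), 0, -32 * (d : ℤ_[l]) ^ 2, -64 * (d : ℤ_[l]) ^ 3⟩ : WeierstrassCurve ℤ_[l])
    PadicInt.irreducible_p (α := 0) (β := -3 * (e : ℤ_[l])) (γ := 0) (δ := -32 * (e : ℤ_[l]) ^ 2)
    (ε := -64 * (e : ℤ_[l]) ^ 3) (by simp) (by simp only; rw [hdl]; ring) (by simp) (by simp only; rw [hdl]; ring)
    (by simp only; rw [hdl]; ring) (cellModel_padic_Δ_ne_zero hd0) (residue_cellCubic_disc_ne_zero hl2 hl7' he)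
    S hS
  rw [h, hS3]

/-- For squarefree `d` and a prime `ℓ ∣ d`: `d = ℓ·e` with `ℓ ∤ e`. [folklore] -/
theorem exists_eq_mul_not_dvd_of_squarefree (hsq : Squarefree d) (hl : l.Prime) (hld : (l : ℤ) ∣ d) :
    ∃ e : ℤ, d = l * e ∧ ¬ (l : ℤ) ∣ e := by
  obtain ⟨e, rfl⟩ := hld
  refine ⟨e, rfl, fun hle => ?_⟩
  have hll : (l : ℤ) * l ∣ l * e := mul_dvd_mul_left _ hle
  have hu := hsq (l : ℤ) hll
  rw [Int.isUnit_iff] at hu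
  have := hl.one_lt
  omega

/-- **`c_ℓ(49a1^{(d)}) = 2` at an odd prime `ℓ ∣ d`, `ℓ ≠ 7`, INERT in `ℚ(√−7)`** (`(−7/ℓ) = −1`), for every squarefree
`d ≢ 1 (mod 4)` (Mathlib's `ℓ`-adics; read on the minimal model `M_d ⊗ ℚ_ℓ`, §0).
[cite: Silverman1994, IV.9.4 Step 6 and Table 4.1] [cite: Tate1975, §7 (case 6)] -/
theorem localTamagawaNumber_padic_cellModel_eq_two (hsq : Squarefree d) (hd4 : d % 4 ≠ 1) [Fact l.Prime]
    (hl2 : l ≠ 2) (hl7' : l ≠ 7) (hld : (l : ℤ) ∣ d) (hl7 : legendreSym l (-7) = -1) :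
    (haveI := cm7.isElliptic_quadraticTwist (show (((4 * d : ℤ)) : ℚ) ≠ 0 by
       have := hsq.ne_zero; exact_mod_cast (show (4 * d : ℤ) ≠ 0 by omega))
     ((cm7.quadraticTwist (((4 * d : ℤ)) : ℚ)).baseChange ℚ_[l]).localTamagawaNumber ℤ_[l]) = 2 := by
  have hl : l.Prime := Fact.out
  have hd : (((4 * d : ℤ)) : ℚ) ≠ 0 := by
    have := hsq.ne_zero; exact_mod_cast (show (4 * d : ℤ) ≠ 0 by omega)
  haveI := cm7.isElliptic_quadraticTwist hd
  obtain ⟨e, hde, he⟩ := exists_eq_mul_not_dvd_of_squarefree hsq hl hld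
  -- minimality at `ℓ`
  set w : HeightOneSpectrum (𝓞 ℚ) := (primesEquiv (R := 𝓞 ℚ)).symm ⟨l, hl⟩ with hw
  have hwl : ((primesEquiv w : Nat.Primes) : ℕ) = l := by rw [hw, Equiv.apply_symm_apply]
  haveI : ((⟨0, -3 * (d : ℤ_[l]), 0, -32 * (d : ℤ_[l]) ^ 2, -64 * (d : ℤ_[l]) ^ 3⟩ :
      WeierstrassCurve ℤ_[l]).baseChange ℚ_[l]).IsMinimal ℤ_[l] := by
    have hmin := (isGloballyMinimal_cellModel hsq hd4).isMinimal w
    have h2 := (isMinimalAt_iff_isMinimal_padic w l hwl _).mp hmin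
    rwa [cellModel_baseChange_padic] at h2
  have hJ : (1 : VariableChange ℚ_[l]) • (cm7.quadraticTwist (((4 * d : ℤ)) : ℚ)).baseChange ℚ_[l] =
      (⟨0, -3 * (d : ℤ_[l]), 0, -32 * (d : ℤ_[l]) ^ 2, -64 * (d : ℤ_[l]) ^ 3⟩ : WeierstrassCurve ℤ_[l]).baseChange
        ℚ_[l] := by
    rw [one_smul, ← cellModel_baseChange, cellModel_baseChange_padic]
  rw [LocalIndex.localTamagawaNumber_eq_index_of_smul_eq_baseChange _ _ _ hJ]
  exact index_nonsingularReductionSubgroup_cellModel_eq_two hl2 hl7' hl7 he hde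

/-- **`c_ℓ(49a1^{(d)}) = 4` at an odd prime `ℓ ∣ d`, `ℓ ≠ 7`, SPLIT in `ℚ(√−7)`** (`(−7/ℓ) = +1`), for every squarefree
`d ≢ 1 (mod 4)`. [cite: Silverman1994, IV.9.4 Step 6 and Table 4.1] [cite: Tate1975, §7 (case 6)] -/
theorem localTamagawaNumber_padic_cellModel_eq_four (hsq : Squarefree d) (hd4 : d % 4 ≠ 1) [Fact l.Prime]
    (hl2 : l ≠ 2) (hl7' : l ≠ 7) (hld : (l : ℤ) ∣ d) (hl7 : legendreSym l (-7) = 1) :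
    (haveI := cm7.isElliptic_quadraticTwist (show (((4 * d : ℤ)) : ℚ) ≠ 0 by
       have := hsq.ne_zero; exact_mod_cast (show (4 * d : ℤ) ≠ 0 by omega))
     ((cm7.quadraticTwist (((4 * d : ℤ)) : ℚ)).baseChange ℚ_[l]).localTamagawaNumber ℤ_[l]) = 4 := by
  have hl : l.Prime := Fact.out
  have hd : (((4 * d : ℤ)) : ℚ) ≠ 0 := by
    have := hsq.ne_zero; exact_mod_cast (show (4 * d : ℤ) ≠ 0 by omega)
  haveI := cm7.isElliptic_quadraticTwist hd
  obtain ⟨e, hde, he⟩ := exists_eq_mul_not_dvd_of_squarefree hsq hl hld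
  set w : HeightOneSpectrum (𝓞 ℚ) := (primesEquiv (R := 𝓞 ℚ)).symm ⟨l, hl⟩ with hw
  have hwl : ((primesEquiv w : Nat.Primes) : ℕ) = l := by rw [hw, Equiv.apply_symm_apply]
  haveI : ((⟨0, -3 * (d : ℤ_[l]), 0, -32 * (d : ℤ_[l]) ^ 2, -64 * (d : ℤ_[l]) ^ 3⟩ :
      WeierstrassCurve ℤ_[l]).baseChange ℚ_[l]).IsMinimal ℤ_[l] := by
    have hmin := (isGloballyMinimal_cellModel hsq hd4).isMinimal w
    have h2 := (isMinimalAt_iff_isMinimal_padic w l hwl _).mp hmin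
    rwa [cellModel_baseChange_padic] at h2
  have hJ : (1 : VariableChange ℚ_[l]) • (cm7.quadraticTwist (((4 * d : ℤ)) : ℚ)).baseChange ℚ_[l] =
      (⟨0, -3 * (d : ℤ_[l]), 0, -32 * (d : ℤ_[l]) ^ 2, -64 * (d : ℤ_[l]) ^ 3⟩ : WeierstrassCurve ℤ_[l]).baseChange
        ℚ_[l] := by
    rw [one_smul, ← cellModel_baseChange, cellModel_baseChange_padic]
  rw [LocalIndex.localTamagawaNumber_eq_index_of_smul_eq_baseChange _ _ _ hJ]
  exact index_nonsingularReductionSubgroup_cellModel_eq_four hl2 hl7' hl7 he hde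

end OddPlace

/-! ## §2 `(−7/ℓ) = (ℓ/7)`: the two spellings of «inert / split in `ℚ(√−7)`» -/

/-- **`(−7/ℓ) = (ℓ/7)` for every odd `ℓ`** (quadratic reciprocity; `−7 ≡ 1 (mod 4)`): the cell's two spellings of
«`ℓ` inert in `ℚ(√−7)`» — `(−7/ℓ) = −1` (Coates–Li–Tian–Zhai) and `(ℓ/7) = −1` (LINE B49) — agree, and likewise for
«split». Cases `ℓ ≡ 1 (mod 4)` (`jacobiSym_neg_seven_eq`) and `ℓ ≡ 3 (mod 4)` (`jacobiSym_neg_seven_eq_of_three_mod_four`)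
are seat c3's lemmas; this is their union. [folklore] -/
theorem jacobiSym_neg_seven_eq_of_odd {l : ℕ} (hl : Odd l) : jacobiSym (-7) l = jacobiSym l 7 := by
  rcases Nat.odd_mod_four_iff.mp (Nat.odd_iff.mp hl) with h1 | h3
  · rw [jacobiSym.neg _ hl, ZMod.χ₄_nat_one_mod_four h1, one_mul]
    exact_mod_cast jacobiSym.quadratic_reciprocity_one_mod_four' (by norm_num : Odd 7) h1
  · rw [jacobiSym.neg _ hl, ZMod.χ₄_nat_three_mod_four h3]
    have h := jacobiSym.quadratic_reciprocity_three_mod_four (by decide : 7 % 4 = 3) h3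
    rw [show ((7 : ℕ) : ℤ) = 7 from rfl] at h
    rw [h]
    ring

/-- For an odd prime `ℓ`: `legendreSym ℓ (−7) = (ℓ/7)`. [folklore] -/
theorem legendreSym_neg_seven_eq_jacobiSym {l : ℕ} [Fact l.Prime] (hl2 : l ≠ 2) :
    legendreSym l (-7) = jacobiSym l 7 := by
  rw [jacobiSym.legendreSym.to_jacobiSym]
  exact jacobiSym_neg_seven_eq_of_odd ((Fact.out : l.Prime).odd_of_ne_two hl2)

end Summit.BirchSwinnertonDyer.BirchSwinnertonDyer.Theorems.GoldfeldGoodTwists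

end
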